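import Literature.MathematicalPhysics.QuantumFieldTheory.Balaban1983to89.B15Chi124DetSets
import Literature.MathematicalPhysics.QuantumFieldTheory.Balaban1983to89.B15Bounds199

/-!
# `Balaban1983to89.B15Claim189Assembly` — T. Bałaban, *Large field renormalization. I. The basic step of the 𝐑 operation*,
# Commun. Math. Phys. **122** (1989) 175–202 [Balaban1989LargeFieldI] = «[IV]», (1.89) p. 198 (proof pp. 198–200): THE ONE-THEOREM
# ASSEMBLY — *"with the new functions introduced in the integral, we can drop the function χ″_k"* (p. 198) — in the typed
# implication form `B15.BasicStep.Claim189 remaining dropped` with `remaining` THE PRINTED PRODUCT `χ_k(Ω_k^{∼4})χ_{k,Λ}χ_{h,1/2}χ′`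
# (the half-threshold functions `χ_{h,1/2}` CONCRETE as r12's (1.88) letter `SFhalf188`) and `dropped` ∋ THE CONCRETE `χ″_k`
# (`B15Chi124DetSets.Chi124` at `j = k`), knitted PER PLAQUETTE on r12's regions from the printed leaves (1.90)–(1.91),
# (1.93)–(1.95), the two (1.91)-type bounds of p. 199 and (1.80) through the tree's kernel theorems `ineq196_first_of_191_195`,
# `ineq198` (`B15Ineq196Proof`), `lines124N_of_bounds` (`B15Claim189Cases`) and `chi124_top_of_lines` (`B15Chi124DetSets`)

statement-level skeleton of published theorems with citation tags; proofs where landed; nothing here is a claim about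
the Yang–Mills mass gap

PDF held: `paper:balaban1989-cmp122-large-field-i` (journal page = PDF page + 174).  (1.88)–(1.98) and the proof text
pp. 197–200 were READ AS IMAGES by this seat on the ×2 renders `run/shared/lean/pub/pub-balaban/b2b-balaban-ref1/pages/
1989-cmp122-large-field-I/1989-cmp122-large-field-I-p023-x2.png` … `-p026-x2.png` (pp. 197–200).

CITATION HEADER / WHAT IS REPRODUCED (mega-formalization `lit-balaban`, HOME `run/shared/lean/pub/lit-balaban/`; Phase-2 proof
seat `lit-balaban-p29` gen 41 under the free-target protocol G.5-34 (d); block B15, fold owner r12 (auto-wake-gated), PROXY r11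
under G.5-61).  SKELETON row served: **B15.Eq1.89** (CLAIM; cells only — the head is the owner's ∕ lead's business) — r12's
`lit-balaban-r12/ROWS-B15.md` cell, verbatim: *"ASSEMBLY `lines124N_of_bounds`: the pp.199–200 per-domain bounds give ALL lines
of (1.24) at n = N, `claim189_of_chain` ⇒ `Claim189 remaining dropped` once the remaining χ's imply those bounds … head stays
typed-existing: the ℍ-bounds (1.90)/(1.94)/p.199, (1.80) and the geometry (dist(p,Λ) ≥ shell sum; admissibility) are
leaves/hypotheses · xref gen 12: `B15Chi124DetSets.claim189_chi124` … `Claim189 remaining dropped` with dropped := the CONCRETE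
χ″_k = `Chi124 … k k` … from the chain hypothesis"*.  THIS FILE DISCHARGES THAT CHAIN HYPOTHESIS down to the printed
per-plaquette leaves: `remaining` is print's product with its letters, and the implication «leaves ⇒ per-domain bounds ⇒
lines of (1.24) ⇒ χ″_k» is kernel-checked at the concrete regions.

THE PRINT (pp. 198–200 [PDF 24–26], verbatim).  p. 198: *"Now we prove that, with the new functions introduced in the integral,
we can drop the function χ″_k, i.e., we have the equality χ_k(Ω_k^{∼4})χ_{k,Λ}χ_{h,1/2}((Ω″^∼_{h+1})ᶜ∩Ω_h)χ′χ_h(Ω_h∩Z_h)χ″_k =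
χ_k(Ω_k^{∼4})χ_{k,Λ}χ_{h,1/2}((Ω″^∼_{h+1})ᶜ∩Ω_h)χ′. (1.89) We have assumed that β ≦ 1/4. The equality χ_h(Ω_h∩Z_h) = 1 is
immediate, so we have to prove that χ″_k = 1. We have already done several reasonings of this type, so now we will sketch
only main points. Take a cube □ ⊂ (Ω″^∼_{h+1})ᶜ∩Ω_h, and represent the functions U″_{k,Z} on □^∼ in the usual way: [(1.90)].
The function ℍ_{h,□} and it[s] derivatives can be bounded on □^∼ by B₃exp(−δ2LM₂R_h)11d²ε_h < 11d²B₃exp(−R_h)ε_h < αε_h,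
where α is a small, absolute constant, which will be fixed later. Estimating as in (1.46) we get |U″_{k,Z}(∂p) − 1| <
|U_{h,□}(V″, ∂p) − 1|(1 + L^{−h}αε_h) + (α + 8α²ε_h)ε_h(L^{k−h}η)² for p ⊂ □^∼. (1.91)"*; p. 199: *"[(1.93) and the bound
(1.94) < αε_h] … we get |U_{h,□}(V″, ∂p) − 1| < |U_{h,□}((1, V_h), ∂p) − 1|(1 + L^{−h}αε_h) + (α + 8α²2ε_h)ε_h(L^{k−h}η)² <
½(1 + L^{−h}αε_h)ε_h(L^{k−h}η)² + (α + 8α²ε_h)ε_h(L^{k−h}η)². (1.95) The estimates (1.91), (1.95) yield |U″_{k,Z}(∂p) − 1| <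
¾ε_h(L^{k−h}η)² < (1 − β(1 − 2^{−(k−h+1)}))ε_h(L^{k−h}η)² (1.96) for p ⊂ □^∼, hence on the whole domain (Ω″^∼_{h+1})ᶜ∩Ω_h. We
have chosen α = 1/12 in (1.91), (1.94), (1.95). Consider now the function U″_{k,Z} on the domain Ω″^∼_{h+1}∩Ω^c_k. … The
ℍ-function in the expansion can be bounded on the domain Z″_{j+1}∖Z″_j for h < j < k, Z″_{h+1}∖(Ω″^∼_{h+1})ᶜ for j = h, and
Ω^c_k∖Z″_k for j = k, by … < αε_j. This yields the bound (1.91) with h replaced by j, and the configuration U_{h,□}(V″) replaced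
by [(1.97)]. … The plaquette variables for the configuration (1.97) are bounded again as in (1.91), with h replaced by j, and
with U_{h,□}(V″) replaced by (1.97) for B′ = 0. This configuration is equal to U₀^{ū₀} … The plaquette variables of U₀^{ū₀}
satisfy the estimate (1.80). Combining the above estimates, and using the inequality ε_kη² ≦ (1 + β₀)(k − j)^{1/2}L^{−2(k−j)}
ε_j(L^{k−j}η)² ≦ L^{−(k−j)}ε_j(L^{k−j}η)² for j < k, we obtain [(1.98)] on the j^{th} domain described above."*; p. 200: *"Now
we have to analyze this bound on all the domains in the definition (1.24). Consider Ω_m∖Ω_{m+1} for k₀ < m < k. We have j = k,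
… hence the last term in the bound (1.98) can be made arbitrarily small for M large enough. Making it smaller than α, and
taking α ≦ 1/8, … for m = k − 1 [3(1 − β(1/2))ε_kη², i.e. the top line of (1.24) with c = 3] … if O(1)B₃B₅M⁵L₀^{−2(N₀−1)} ≦
1/4. … Thus we have proved that the configuration U″_{k,Z} satisfies all the conditions in the definition (1.24), hence
χ″_k = 1, and the equality (1.89) is proved."*  (The p. 200 case analysis is r12's `B15Claim189Cases`; (1.96)/(1.98) from the
leaves are r12's `B15Ineq196Proof`; `χ″_k` at the concrete regions is r12's `B15Chi124DetSets.Chi124 … k k`.)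

WHAT IS PROVED (theorems only; 0 `def … : Prop` facts, 0 `sorry`, standard axioms).
§1 region bookkeeping: nested `Ω`'s are antitone (the union splitting of p40's `plaqsOf` is p29's landed
   `B15Claim129Assembly.plaqsOf_union_subset`, inlined at its one use to keep the imports on built modules).
§2 THE LETTERED DATA `Setting189` (which configuration-valued ∕ real-valued map each printed symbol denotes: `U″_{k,Z}`,
   `U_{h,□}((1, V_h))`, `U_{h,□}(V_h)`, the deviations `|U_{h,□}(V″,∂p) − 1|`, `|(1.97)(∂p) − 1|`, `|U₀^{ū₀}(∂p) − 1|`, the region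
   `Ω″^∼_{h+1}`, `dist(p, Λ)`, the constants), the printed functions `new189` (= `χ_k(Ω_k^{∼4})χ_{k,Λ}χ_{h,1/2}χ′`, the first,
   second and fourth as abstract letters — they act only through the leaves — and `χ_{h,1/2}` = r12's `SFhalf188` per cube),
   `chiH` (= `χ_h(Ω_h∩Z_h)`, the (1.3)-letter `SF13` at level `h` per cube), `chiPP` (= `χ″_k` = `Chi124 … k k` at `U″_{k,Z}`),
   the three p. 199 ℍ-domains `dom` (`Z″_{h+1}∩Ω_h∩Ω″^∼_{h+1}` for `j = h`, `Z″_{j+1}∖Z″_j` for `h < j < k`, `Ω^c_k∖Z″_k` for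
   `j = k`), the half domain `half` (= `(Ω″^∼_{h+1})ᶜ∩Ω_h`) and the «increased O(1)» coefficient `X j = O(1)(1 + L^{−j}αε_j)²B₃B₅M⁵`;
   `hlast_of_largeM` — p. 200 *"Making it smaller than α"*: the `hlast` input of §3 from the shell-sum geometry and `M` large
   (r12's `lastTerm_le`); `hscale_of_flow` — the `hscale` input of §3 (p. 199's units inequality) from the [III] flow relation
   `ε_k ≦ (1+β₀)(k−j)^{1/2}ε_j` (r12's `B15Bounds199.chainD`).
§3 **`claim189_assembly`** — (1.89)'S PROVED PART AS ONE KERNEL THEOREM: `Claim189 (new189 D) (chiPP D)`, i.e. for every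
   configuration with `χ_k(Ω_k^{∼4})χ_{k,Λ}χ_{h,1/2}χ′ ≠ 0` the configuration `U″_{k,Z}` satisfies ALL the conditions of (1.24)
   at `n = N` on the concrete regions, FROM: the printed leaves as hypotheses over `new189` — (1.90)–(1.91) (`Ineq191` for
   `U″_{k,Z}` against `U_{h,□}(V″)` on the half domain), (1.93)–(1.95) (`Ineq195` for `U_{h,□}(V″)` against `U_{h,□}((1, V_h))`
   of the cube `□^∼ ∋ p`), the two (1.91)-type bounds of p. 199 (`Ineq191` with `h ↦ j` for `U″_{k,Z}` against (1.97), and for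
   (1.97) against `U₀^{ū₀}`) and (1.80) (`B15.Ineq180` for `U₀^{ū₀}`) on the `j`-th ℍ-domain, `h ≦ j ≦ k`; the printed flow
   inequality `ε_kη² ≦ L^{−(k−j)}ε_j(L^{k−j}η)²` (`j < k`); the p. 200 located inputs AS PRINTED — *"We have j = k"* (the domains
   `Ω_m∖Ω_{m+1}`, `k₀ < m < k`, lie in the `j = k` ℍ-domain), *"Making [the last term] smaller than α"*, *"if O(1)B₃B₅M⁵
   L₀^{−2(N₀−1)} ≦ 1/4"* (r12's `X′`-form), `dist(p, Λ) ≧ 0`; the cube geometry of (1.88) (*"for p ⊂ □^∼, hence on the whole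
   domain"*); the numerics `α = 1/12` (p. 199; `≦ 1/8` p. 200), `0 ≦ β ≦ 1/4` (p. 198), `2 ≦ L₀`, `L₀² ≦ L` (p. 191), `0 ≦ ε_i ≦
   1/10`, `O(1)B₃B₅M⁵ ≧ 0`, `h ≦ k₀`, `k₀ + 2 ≦ k` (`N₀ ≧ 2`: the top domain `Ω_{k−1}` is one of the `Ω_m`,
   `k₀ < m`), nested `Ω`'s with `Ω_{k+1} := Ω_k` at the top level (p. 200 applies the top line, `c = 3`, on `Ω_{k−1}∖Ω_k`).
   Proof = `ineq196_first_of_191_195` on the half domain, `ineq198` on the three ℍ-domains, `lines124N_of_bounds`,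
   `chi124_top_of_lines`, with the region bookkeeping `Z″_{h+1}∩Ω_h ⊆ (Z″_{h+1}∩Ω_h∩Ω″^∼_{h+1}) ∪ ((Ω″^∼_{h+1})ᶜ∩Ω_h)`,
   `Ω^c_{k₀+1}∖Z″_k ⊆ Ω^c_k∖Z″_k`, `Ω_{k−1}∖Ω_{k+1} ⊆ Ω_{k−1}∖Ω_k`.
   `claim189_assembly_of_flow` — the same with `hscale`, `hlast` replaced by their printed sources (the [III] flow relation;
   the p. 200 shell geometry `4(m − k₀)M ≦ dist(p, Λ)` and the choice of `M`).
   `claim189_assembly_with_chiH` — the full printed right-hand deletion `χ_h(Ω_h∩Z_h)χ″_k` with print's *"The equality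
   χ_h(Ω_h∩Z_h) = 1 is immediate"* as the (unargued, verbatim-labelled) input; `claim189_assembly_indicator` — the printed
   product form `χ_new·χ″_k = χ_new` via r12's `claim129_iff_indicator`.
HONEST SCOPE.  (i) Bookkeeping over the tree's typed leaves; the analytic content — the representations (1.90), (1.93), (1.97),
the ℍ-bounds (1.91)₁, (1.94), p. 199, the expansions giving (1.91)/(1.95) and their `h ↦ j` versions, (1.80), the [III] flow
relation (behind `hscale`, cf. `hscale_of_flow`), the geometry of the admissible families (which is why *"We have j = k"*, the shell-sum bound behind *"smaller
than α"* — r12's `lastTerm_le` ∕ `exists_M_lastTerm_lt` ∕ `exp_shells_le_along_flow` discharge it from `dist(p, Λ) ≧` the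
shell sum — and the cube cover of (1.88) are hypotheses) — stays in the hypotheses, each labelled with its printed locator.
(ii) `Setting189` is DATA: it records print's letters, not their constructions ((1.20), (1.81), (1.85)–(1.86), (1.92)).
(iii) `χ_k(Ω_k^{∼4})`, `χ_{k,Λ}` ((1.75)), `χ′` ((1.82)) are abstract `C → Prop` letters: in the printed argument they act only
through the leaves ((1.80) ⇐ `χ_{k,Λ}` via (1.78)–(1.79); the ℍ-bound `B₃δ′_k < αε_j` ⇐ `χ′`); their typed forms are r12's
`Chi175` ∕ `SF182`.  (iv) `χ_h(Ω_h∩Z_h) = 1` is NOT derived here (print: *"immediate"*, no argument) — it is an input of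
`claim189_assembly_with_chiH` and absent from `claim189_assembly`.  (v) The level bookkeeping is print's displayed case
`N₀ = k − k₀ ≧ 2`, `h ≦ k₀` (r12's READING (a) in `B15Chi124DetSets` ∕ `B15Claim189Cases`).  (vi) At the top level the
(1.24) symbol `Ω_{j+1} = Ω_{k+1}` is READ as `Ω_k` (`hΩtop`, with the nesting `hΩ`): p. 200 verifies the top line (`c = 3`) on
`Ω_{k−1}∖Ω_k` (*"for m = k − 1"*); the plaquettes of `Ω_k` itself (where the remaining function `χ_k(Ω_k^{∼4})` acts) are not
discussed by the printed sketch and are outside `Chi124 … k k` under this reading — the same reading as r12's `hStop` ∕ `hA`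
(`B15Chi124DetSets.chi124_top_of_lines`, `B15Claim189Cases.lines124N_of_bounds`).  (vii) PRINT'S INSTANCES of the letters
exist in the tree and are NOT imported here (the implication does not need them; this also keeps the verify path on built
modules): `Upp V = U″_{k,Z}` = r11's `B15Sect1Instances.bgPPZstd` ((1.21)), whence `chiPP` = r11's `chi124std … k₀ (k − h)`;
`chiΛ` = r11's `chi175std` ((1.75)); `chi'` = p29's `B15Sect1ChartInstances.chiPrime182std` ((1.82)); `Uhalf V □` ∕ `UboxH V □` =
`ukBox bg M₁ (enl4 □) h (oneOn Ω″^{∼2}_{h+1} h (V h))` ∕ `ukBox bg M₁ (enl4 □) h (V h)` (r11's `B15Eq13Concrete.chiHalf` ∕ `chi13`,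
[III] (2.16)); `chiΩ4` = the [III] (2.17) function `χ_k` on `Ω_k^{∼4}` (r11's `chi217`).  Value = the row's printed proof
architecture kernel-checked end-to-end at the concrete regions with every constant as printed; NOT summit progress and no
claim about the adjudicated mathematics.  Unit `lit-balaban-p29` (literature-prover-lit-balaban-p29-g41-0).
-/

namespace Literature.MathematicalPhysics.QuantumFieldTheory.Balaban1983to89.B15Claim189Assembly

open Literature.MathematicalPhysics.QuantumFieldTheory.Balaban1983to89
open B15.BasicStep B15.PrelimIntegrations B15Chi124DetSets B15Claim189Cases B15Ineq196Proof B15Bounds199 B8Eq17ClassAkV1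
open GaugeField

variable {P : Params}

/-! ## §1  Region bookkeeping -/

/-- Nested regions `Ω_{i+1} ⊆ Ω_i` (the sequences of (1.10)–(1.11), p. 179) are antitone: `Ω_b ⊆ Ω_a` for `a ≦ b`.
Bookkeeping. [cite: Balaban1989LargeFieldI, (1.10) p.179] -/
theorem Ω_antitone {Ω : ℕ → Set (Site P 0)} (hΩ : ∀ i, Ω (i + 1) ⊆ Ω i) {a b : ℕ} (hab : a ≤ b) : Ω b ⊆ Ω a :=
  (antitone_nat_of_succ_le hΩ) hab

/-! ## §2  The lettered data of (1.89) and the printed functions -/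

/-- THE LETTERED DATA OF (1.89) over an abstract space `C` of configurations (the integration variables `V_h`, `V′`, `V_k`, …
of (1.76) and everything they determine).  `Ω i`, `Zpp i` = the regions `Ω_i`, `Z″_i ⊂ T_η` (r12's point-set model
`B15DeterminingSets`); `OmT` = `Ω″^∼_{h+1}`; `h`, `k₀ = k − N₀`, `k` the scales; `β`, `L₀`, `L`, `η`, `ε i = ε_i`, `α`, `δ`, `B₃`,
`B₅`, `M` the printed numbers and `O1` the `O(1)` of (1.80)/(1.98); `dist p = dist(p, Λ)`; `chiΩ4 = χ_k(Ω_k^{∼4})`, `chiΛ =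
χ_{k,Λ}` ((1.75)), `chi' = χ′` ((1.82)) as letters; the cube families are indexed by a cube type `ι` (the `LM₂R_h`-cubes of
`T_{L^{−h}}`) exactly as in r11's concrete `B15Eq13Concrete.chiHalf` ∕ `chi13` (`chiHalf_eq_one_iff`, `chi13_eq_one_iff`): `plaqT □`
= the plaquettes of `□^∼`, `halfcubes` = the cubes of the product `χ_{h,1/2}((Ω″^∼_{h+1})ᶜ∩Ω_h)` (p. 198: *"the product over cubes
□ intersecting the domain (Ω″^{∼2}_{h+1})ᶜ, and contained in Ω_h"*) with `Uhalf U □ = U_{h,□}((1, V_h))`, `boxOf p` = the cube with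
`p ⊂ □^∼` used for `p` (p. 199 *"for p ⊂ □^∼, hence on the whole domain"*); `cubesH` ∕ `UboxH U □ = U_{h,□}(V_h)` the cubes
`□ ⊂ Ω_h∩Z_h` of `χ_h(Ω_h∩Z_h)` ((1.3) at level `h`); `Upp U = U″_{k,Z}`;
`devV'' U p = |U_{h,□}(V″, ∂p) − 1|` ((1.91)), `dev97 U p = |(1.97)(∂p) − 1|`, `dev0 U p = |U₀^{ū₀}(∂p) − 1|` (p. 199).
DATA only (HONEST SCOPE (ii)). [cite: Balaban1989LargeFieldI, (1.89) p.198] -/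
structure Setting189 (P : Params) (G C ι : Type*) where
  Ω : ℕ → Set (Site P 0)
  Zpp : ℕ → Set (Site P 0)
  OmT : Set (Site P 0)
  h : ℕ
  k₀ : ℕ
  k : ℕ
  β : ℝ
  L₀ : ℝ
  L : ℝ
  η : ℝ
  ε : ℕ → ℝ
  α : ℝ
  δ : ℝ
  B₃ : ℝ
  B₅ : ℝ
  M : ℝ
  O1 : ℝ
  dist : Plaq P 0 → ℝ
  chiΩ4 : C → Prop
  chiΛ : C → Prop
  chi' : C → Prop
  plaqT : ι → Set (Plaq P 0)
  halfcubes : Set ι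
  Uhalf : C → ι → GaugeField P 0 G
  boxOf : Plaq P 0 → ι
  cubesH : Set ι
  UboxH : C → ι → GaugeField P 0 G
  Upp : C → GaugeField P 0 G
  devV'' : C → Plaq P 0 → ℝ
  dev97 : C → Plaq P 0 → ℝ
  dev0 : C → Plaq P 0 → ℝ

variable {G C ι : Type*}

/-- The `j = h` ℍ-domain of p. 199, *"Z″_{h+1}∖(Ω″^∼_{h+1})ᶜ for j = h"*, intersected with `Ω_h` (where the `i = h` line of
(1.24) tests): `Z″_{h+1}∩Ω_h∩Ω″^∼_{h+1}`. [cite: Balaban1989LargeFieldI, p.199] -/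
def domH (D : Setting189 P G C ι) : Set (Site P 0) := D.Zpp (D.h + 1) ∩ D.Ω D.h ∩ D.OmT

/-- The `h < j < k` ℍ-domains of p. 199, *"Z″_{j+1}∖Z″_j for h < j < k"*. [cite: Balaban1989LargeFieldI, p.199] -/
def domJ (D : Setting189 P G C ι) (j : ℕ) : Set (Site P 0) := D.Zpp (j + 1) \ D.Zpp j

/-- The `j = k` ℍ-domain of p. 199, *"Ω^c_k∖Z″_k for j = k"*. [cite: Balaban1989LargeFieldI, p.199] -/
def domK (D : Setting189 P G C ι) : Set (Site P 0) := (D.Ω D.k)ᶜ \ D.Zpp D.k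

/-- *"the j^{th} domain described above"* (p. 200), `h ≦ j ≦ k`: `domH` for `j = h`, `domK` for `j = k`, `domJ j` otherwise.
[cite: Balaban1989LargeFieldI, (1.98) p.200, p.199] -/
def dom (D : Setting189 P G C ι) (j : ℕ) : Set (Site P 0) :=
  if j = D.h then domH D else if j = D.k then domK D else domJ D j

/-- The half domain `(Ω″^∼_{h+1})ᶜ∩Ω_h` of `χ_{h,1/2}` ((1.88)–(1.89), (1.96)). [cite: Balaban1989LargeFieldI, (1.96) p.199] -/
def half (D : Setting189 P G C ι) : Set (Site P 0) := D.OmTᶜ ∩ D.Ω D.h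

/-- The coefficient of the last term of (1.98), second line, *"O(1)B₃B₅M⁵"* *"with an increased O(1)"* made explicit as in
r12's `B15Ineq196Proof.ineq198`: `X_j = O(1)(1 + L^{−j}αε_j)²B₃B₅M⁵`. [cite: Balaban1989LargeFieldI, (1.98) p.200] -/
noncomputable def X (D : Setting189 P G C ι) (j : ℕ) : ℝ :=
  D.O1 * (1 + (D.L ^ j)⁻¹ * D.α * D.ε j) ^ 2 * D.B₃ * D.B₅ * D.M ^ 5

/-- `dom` at `j = h`. [cite: Balaban1989LargeFieldI, p.199] -/
@[simp] theorem dom_h (D : Setting189 P G C ι) : dom D D.h = domH D := by simp [dom]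

/-- `dom` at `j = k` (`h ≠ k`). [cite: Balaban1989LargeFieldI, p.199] -/
theorem dom_k (D : Setting189 P G C ι) (hkh : D.k ≠ D.h) : dom D D.k = domK D := by simp [dom, hkh]

/-- `dom` at `h < j < k`. [cite: Balaban1989LargeFieldI, p.199] -/
theorem dom_j (D : Setting189 P G C ι) {j : ℕ} (hjh : j ≠ D.h) (hjk : j ≠ D.k) : dom D j = domJ D j := by
  simp [dom, hjh, hjk]

/-- p. 200, *"hence the last term in the bound (1.98) can be made arbitrarily small for M large enough. Making it smaller
than α"* — how the hypothesis `hlast` of `claim189_assembly` below is met: if `dist(p, Λ)` dominates the shell sum of the first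
display of p. 200, itself `≧ 4(m − k₀)M` (r12's `B15Claim189Cases.shellSum_ge` ∕ `exp_shells_le_along_flow`; the geometric
domination is the admissibility of the regions, not modelled), and `M` is so large that `X_k·e^{−4δM} ≦ α` (r12's
`exists_M_lastTerm_lt`), then `X_k·e^{−δ·dist(p, Λ)} ≦ α` on `Ω_m∖Ω_{m+1}`, `k₀ < m` (r12's `lastTerm_le`). [cite: Balaban1989LargeFieldI, p.200] -/
theorem hlast_of_largeM (D : Setting189 P G C ι) (hδ : 0 ≤ D.δ) (hM : 0 ≤ D.M) (hX : 0 ≤ X D D.k)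
    (hlarge : X D D.k * Real.exp (-(4 * D.δ * D.M)) ≤ D.α) {m : ℕ} (hm : D.k₀ < m) {p : Plaq P 0} {Ssum : ℝ}
    (hS : 4 * ((m : ℝ) - D.k₀) * D.M ≤ Ssum) (hdist : Ssum ≤ D.dist p) :
    X D D.k * Real.exp (-D.δ * D.dist p) ≤ D.α := by
  have hg : (1 : ℝ) ≤ (m : ℝ) - D.k₀ := by
    have : (D.k₀ : ℝ) + 1 ≤ m := by exact_mod_cast hm
    linarith
  exact (lastTerm_le hX hδ hM hdist hS hg).trans hlarge

/-- p. 199, *"using the inequality ε_kη² ≦ (1 + β₀)(k − j)^{1/2}L^{−2(k−j)}ε_j(L^{k−j}η)² ≦ L^{−(k−j)}ε_j(L^{k−j}η)² for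
j < k"* — how the hypothesis `hscale` of `claim189_assembly` below is met: from the [III] (2.8) flow relation `ε_k ≦
(1 + β₀)(k − j)^{1/2}ε_j`, `L ≧ 2`, `0 ≦ β₀ ≦ ½`, `ε_j ≧ 0` — r12's `B15Bounds199.chainD`, rewritten in the unit `E_j =
ε_j(L^{k−j}η)²`. [cite: Balaban1989LargeFieldI, p.199] -/
theorem hscale_of_flow (D : Setting189 P G C ι) (hL : 2 ≤ D.L) {β₀ : ℝ} (hβ₀0 : 0 ≤ β₀) (hβ₀ : β₀ ≤ 1 / 2)
    (hε0 : ∀ i, 0 ≤ D.ε i)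
    (hflow : ∀ j, D.h ≤ j → j < D.k → D.ε D.k ≤ (1 + β₀) * Real.sqrt ((D.k - j : ℕ) : ℝ) * D.ε j) :
    ∀ j, D.h ≤ j → j < D.k → D.ε D.k * D.η ^ 2 ≤ (D.L ^ (D.k - j))⁻¹ * E124 D.ε D.L D.η D.k j := by
  intro j hj hjk
  obtain ⟨h1, h2⟩ := chainD (D.k - j) (by omega) (η := D.η) hL hβ₀0 hβ₀ (hε0 j) (hflow j hj hjk)
  have h3 := h1.trans h2
  unfold E124
  simpa [mul_assoc] using h3

variable [GaugeGroup G]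

/-- THE REMAINING FUNCTIONS of (1.89), `χ_k(Ω_k^{∼4})χ_{k,Λ}χ_{h,1/2}((Ω″^∼_{h+1})ᶜ∩Ω_h)χ′`, as one predicate: the letters
`χ_k(Ω_k^{∼4})`, `χ_{k,Λ}`, `χ′` and, CONCRETE, the half-threshold functions of (1.88) — r12's `SFhalf188` (*"sup_{p⊂□^∼}
|U_{h,□}((1, V_h), ∂p) − 1| < ½ε_h(L^{k−h}η)²"*) for every cube of the product. [cite: Balaban1989LargeFieldI, (1.89) p.198] -/
def new189 (D : Setting189 P G C ι) (U : C) : Prop :=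
  D.chiΩ4 U ∧ D.chiΛ U ∧ (∀ c ∈ D.halfcubes, SFhalf188 (D.plaqT c) (D.ε D.h) (D.L ^ (D.k - D.h)) D.η (D.Uhalf U c)) ∧ D.chi' U

/-- `χ_h(Ω_h∩Z_h)` — the small-field function of type (1.3) at level `h` (*"sup_{p⊂□^∼} |U_{h,□}(V_h, ∂p) − 1| < ε_h(L^{k−h}η)²"*,
r12's letter `SF13`) for every cube `□ ⊂ Ω_h∩Z_h`. [cite: Balaban1989LargeFieldI, (1.89) p.198, (1.3) p.178] -/
def chiH (D : Setting189 P G C ι) (U : C) : Prop :=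
  ∀ c ∈ D.cubesH, SF13 (D.plaqT c) (D.ε D.h) (D.L ^ (D.k - D.h)) D.η (D.UboxH U c)

/-- `χ″_k = χ_k^{(N)}` — the function (1.24) at `n = N` (`j = k`) of the configuration `U″_{k,Z}`, CONCRETE on r12's regions:
`B15Chi124DetSets.Chi124 … k k (U″_{k,Z})`. [cite: Balaban1989LargeFieldI, (1.89) p.198, (1.24) p.182] -/
def chiPP (D : Setting189 P G C ι) (U : C) : Prop :=
  Chi124 D.Ω D.Zpp D.h D.k₀ D.k D.k D.β D.L₀ D.ε D.L D.η (D.Upp U)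

/-- The deleted functions of (1.89): `χ_h(Ω_h∩Z_h)χ″_k`. [cite: Balaban1989LargeFieldI, (1.89) p.198] -/
def dropped189 (D : Setting189 P G C ι) (U : C) : Prop := chiH D U ∧ chiPP D U

/-- `new189` unfolded. [cite: Balaban1989LargeFieldI, (1.89) p.198] -/
theorem new189_iff (D : Setting189 P G C ι) (U : C) : new189 D U ↔
    D.chiΩ4 U ∧ D.chiΛ U ∧ (∀ c ∈ D.halfcubes, SFhalf188 (D.plaqT c) (D.ε D.h) (D.L ^ (D.k - D.h)) D.η (D.Uhalf U c)) ∧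
      D.chi' U :=
  Iff.rfl

/-- The `χ_{h,1/2}`-restriction READ PER PLAQUETTE: under `new189`, for `p` in the half domain and the cube `□^∼ ∋ p` of the
cover, `|U_{h,□}((1, V_h), ∂p) − 1| < ½ε_h(L^{k−h}η)²` — the input `hhalf` of r12's `ineq196_first_of_191_195`.
[cite: Balaban1989LargeFieldI, (1.88) p.197, (1.95) p.199] -/
theorem half_lt_of_new189 (D : Setting189 P G C ι) {U : C} (hU : new189 D U)
    (hbox : ∀ p ∈ plaqsOf (half D), D.boxOf p ∈ D.halfcubes ∧ p ∈ D.plaqT (D.boxOf p)) {p : Plaq P 0} (hp : p ∈ plaqsOf (half D)) :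
    dist1 (plaqHol (D.Uhalf U (D.boxOf p)) p) < 1 / 2 * E124 D.ε D.L D.η D.k D.h := by
  obtain ⟨hS, hpS⟩ := hbox p hp
  have h1 := hU.2.2.1 (D.boxOf p) hS p hpS
  have hE : 1 / 2 * D.ε D.h * (D.L ^ (D.k - D.h) * D.η) ^ 2 = 1 / 2 * E124 D.ε D.L D.η D.k D.h := by
    unfold E124; ring
  rw [← hE]
  exact h1

/-! ## §3  (1.89) as ONE kernel theorem -/

/-- **(1.89), THE PROVED PART, AS ONE KERNEL THEOREM** (p. 198 *"so we have to prove that χ″_k = 1"* … p. 200 *"Thus we have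
proved that the configuration U″_{k,Z} satisfies all the conditions in the definition (1.24), hence χ″_k = 1, and the equality
(1.89) is proved"*): `Claim189 (new189 D) (chiPP D)` — for every configuration with `χ_k(Ω_k^{∼4})χ_{k,Λ}χ_{h,1/2}χ′ ≠ 0`, the
configuration `U″_{k,Z}` satisfies (1.24) at `n = N` on the concrete regions (`B15Chi124DetSets.Chi124 … k k`).
HYPOTHESES = the printed leaves and located inputs, each quantified over `new189` where print derives it from the remaining
functions: `L91h` = (1.90)–(1.91) on the half domain; `L95` = (1.93)–(1.95), first inequality, with the deviation of
`U_{h,□}((1, V_h))` at the cube `□^∼ ∋ p` of the cover `hbox` ((1.88)); `L91`, `L97`, `L80` = p. 199: *"This yields the bound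
(1.91) with h replaced by j, and … replaced by (1.97)"*, *"The plaquette variables for the configuration (1.97) are bounded
again as in (1.91) … replaced by (1.97) for B′ = 0 … equal to U₀^{ū₀}"*, *"The plaquette variables of U₀^{ū₀} satisfy the
estimate (1.80)"*, on the `j`-th ℍ-domain `dom D j`, `h ≦ j ≦ k`; `hscale` = *"ε_kη² ≦ … ≦ L^{−(k−j)}ε_j(L^{k−j}η)² for j <
k"*; `hjEqK` = p. 200 *"Consider Ω_m∖Ω_{m+1} for k₀ < m < k. We have j = k"*; `hlast` = *"the last term in the bound (1.98) can
be made arbitrarily small for M large enough. Making it smaller than α"* (discharged from the shell geometry by r12's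
`lastTerm_le` ∕ `exists_M_lastTerm_lt`); `hX'`, `hsmall` = *"with an increased O(1)"*, *"if O(1)B₃B₅M⁵L₀^{−2(N₀−1)} ≦ 1/4"*
(r12's `X′`); `hδ`, `hdist` = `δ ≧ 0`, `dist(p, Λ) ≧ 0`; numerics `α = 1/12` (p. 199), `0 ≦ β ≦ 1/4` (p. 198), `2 ≦ L₀`, `L₀² ≦ L` (p. 191),
`0 ≦ ε_i ≦ 1/10`, `O(1)B₃B₅M⁵ ≧ 0`; levels `h ≦ k₀`, `k₀ + 2 ≦ k`; nested `Ω`'s with `Ω_{k+1} := Ω_k` (`hΩtop`;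
p. 200 uses the top line, `c = 3`, on `Ω_{k−1}∖Ω_k`).  Proof: `ineq196_first_of_191_195` (half domain), `ineq198` (ℍ-domains),
`lines124N_of_bounds`, `chi124_top_of_lines`. [cite: Balaban1989LargeFieldI, (1.89) p.198, pp.199–200] -/
theorem claim189_assembly (D : Setting189 P G C ι) (hhk : D.h ≤ D.k₀) (hk : D.k₀ + 2 ≤ D.k)
    (hΩ : ∀ i, D.Ω (i + 1) ⊆ D.Ω i) (hΩtop : D.Ω D.k ⊆ D.Ω (D.k + 1))
    -- numerics as printed
    (hα : D.α = 1 / 12) (hβ0 : 0 ≤ D.β) (hβ : D.β ≤ 1 / 4) (hL₀ : 2 ≤ D.L₀) (hL₀L : D.L₀ ^ 2 ≤ D.L)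
    (hε0 : ∀ i, 0 ≤ D.ε i) (hε1 : ∀ i, D.ε i ≤ 1 / 10) (hB : 0 ≤ D.O1 * D.B₃ * D.B₅ * D.M ^ 5)
    (hδ : 0 ≤ D.δ) (hdist : ∀ p, 0 ≤ D.dist p)
    -- p. 200: "with an increased O(1)", "if O(1)B₃B₅M⁵L₀^{−2(N₀−1)} ≦ 1/4"
    {X' : ℝ} (hX' : ∀ j, 2 + X D j ≤ X') (hsmall : X' * ((D.L₀ ^ 2) ^ (D.k - D.k₀ - 1))⁻¹ ≤ 1 / 4)
    -- p. 200: "We have j = k" and "Making [the last term] smaller than α" on Ω_m∖Ω_{m+1}, k₀ < m < k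
    (hjEqK : ∀ m, D.k₀ < m → m < D.k → D.Ω m \ D.Ω (m + 1) ⊆ domK D)
    (hlast : ∀ m, D.k₀ < m → m < D.k → ∀ p ∈ plaqsOf (D.Ω m \ D.Ω (m + 1)),
      X D D.k * Real.exp (-D.δ * D.dist p) ≤ D.α)
    -- p. 199: the [III] flow inequality
    (hscale : ∀ j, D.h ≤ j → j < D.k → D.ε D.k * D.η ^ 2 ≤ (D.L ^ (D.k - j))⁻¹ * E124 D.ε D.L D.η D.k j)
    -- (1.88): the cube cover of the half domain
    (hbox : ∀ p ∈ plaqsOf (half D), D.boxOf p ∈ D.halfcubes ∧ p ∈ D.plaqT (D.boxOf p))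
    -- the leaves (1.90)–(1.91), (1.93)–(1.95) on the half domain
    (L91h : ∀ U, new189 D U → ∀ p ∈ plaqsOf (half D),
      Ineq191 (dist1 (plaqHol (D.Upp U) p)) (D.devV'' U p) D.α ((D.L ^ D.h)⁻¹) (D.ε D.h) (E124 D.ε D.L D.η D.k D.h))
    (L95 : ∀ U, new189 D U → ∀ p ∈ plaqsOf (half D),
      Ineq195 (D.devV'' U p) (dist1 (plaqHol (D.Uhalf U (D.boxOf p)) p)) D.α ((D.L ^ D.h)⁻¹) (D.ε D.h)
        (E124 D.ε D.L D.η D.k D.h))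
    -- the leaves of p. 199 on the j-th ℍ-domain: (1.91)[h ↦ j] twice and (1.80)
    (L91 : ∀ U, new189 D U → ∀ j, D.h ≤ j → j ≤ D.k → ∀ p ∈ plaqsOf (dom D j),
      Ineq191 (dist1 (plaqHol (D.Upp U) p)) (D.dev97 U p) D.α ((D.L ^ j)⁻¹) (D.ε j) (E124 D.ε D.L D.η D.k j))
    (L97 : ∀ U, new189 D U → ∀ j, D.h ≤ j → j ≤ D.k → ∀ p ∈ plaqsOf (dom D j),
      Ineq191 (D.dev97 U p) (D.dev0 U p) D.α ((D.L ^ j)⁻¹) (D.ε j) (E124 D.ε D.L D.η D.k j))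
    (L80 : ∀ U, new189 D U → ∀ j, D.h ≤ j → j ≤ D.k → ∀ p ∈ plaqsOf (dom D j),
      B15.Ineq180 (D.dev0 U p) (D.ε D.k) D.η D.B₃ D.B₅ D.M D.δ (D.dist p) D.O1) :
    Claim189 (new189 D) (chiPP D) := by
  intro U hU
  -- elementary consequences of the numerics
  have hα0 : 0 ≤ D.α := by rw [hα]; norm_num
  have hα8 : D.α ≤ 1 / 8 := by rw [hα]; norm_num
  have hL1 : 1 ≤ D.L := by nlinarith
  have hL0 : 0 < D.L := by linarith
  have hLinv0 : ∀ n : ℕ, 0 ≤ (D.L ^ n)⁻¹ := fun n => by positivity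
  have hLinv1 : ∀ n : ℕ, (D.L ^ n)⁻¹ ≤ 1 := fun n => inv_le_one_of_one_le₀ (one_le_pow₀ hL1)
  have hE : ∀ i, 0 ≤ E124 D.ε D.L D.η D.k i := fun i => by
    unfold E124; exact mul_nonneg (hε0 i) (sq_nonneg _)
  have he : 0 ≤ D.ε D.k * D.η ^ 2 := mul_nonneg (hε0 D.k) (sq_nonneg _)
  have hXexp : ∀ p : Plaq P 0, 0 ≤ D.O1 * D.B₃ * D.B₅ * D.M ^ 5 * Real.exp (-D.δ * D.dist p) := fun p =>
    mul_nonneg hB (Real.exp_nonneg _)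
  have hX0 : ∀ j, 0 ≤ X D j := fun j => by
    have : X D j = D.O1 * D.B₃ * D.B₅ * D.M ^ 5 * (1 + (D.L ^ j)⁻¹ * D.α * D.ε j) ^ 2 := by unfold X; ring
    rw [this]; exact mul_nonneg hB (sq_nonneg _)
  have hkh : D.k ≠ D.h := by omega
  have hδdist : ∀ p : Plaq P 0, 0 ≤ D.δ * D.dist p := fun p => mul_nonneg hδ (hdist p)
  -- the (1.98) bound on the `j`-th ℍ-domain, `h ≦ j ≦ k`, from the three leaves (r12's `ineq198`)
  have h198 : ∀ j, D.h ≤ j → j ≤ D.k → ∀ p ∈ plaqsOf (dom D j),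
      dist1 (plaqHol (D.Upp U) p) < (2 * (D.L ^ (D.k - j))⁻¹ + 4 * D.α
        + D.O1 * (1 + (D.L ^ j)⁻¹ * D.α * D.ε j) ^ 2 * D.B₃ * D.B₅ * D.M ^ 5 * Real.exp (-D.δ * D.dist p)
          * (D.L ^ (D.k - j))⁻¹) * E124 D.ε D.L D.η D.k j := by
    intro j hj hjk p hp
    have hsc : D.ε D.k * D.η ^ 2 ≤ (D.L ^ (D.k - j))⁻¹ * E124 D.ε D.L D.η D.k j := by
      rcases Nat.lt_or_ge j D.k with hlt | hge
      · exact hscale j hj hlt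
      · have hjk' : j = D.k := le_antisymm hjk hge
        subst hjk'
        simp [E124]
    exact ineq198 (L91 U hU j hj hjk p hp) (L97 U hU j hj hjk p hp) (L80 U hU j hj hjk p hp) hα0 hα8 (hLinv0 j)
      (hLinv1 j) (hε0 j) (hε1 j) (hE j) (hXexp p) he hsc (hLinv1 _)
  -- r12's p. 200 case analysis at the plaquette families of the four kinds of domains of (1.24) at n = N
  obtain ⟨h1, h2, h3, h4, h5⟩ := lines124N_of_bounds (fun p => dist1 (plaqHol (D.Upp U) p)) hhk (by omega)
    (E124 D.ε D.L D.η D.k) (X D) X' (fun i => (1 / 2 : ℝ) ^ (D.k - i + 1)) D.dist hα8 hβ0 hβ hL₀ hL₀L hE hX0 hX'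
    (fun j => ⟨by positivity, pow_le_one₀ (by norm_num) (by norm_num)⟩) hδdist hsmall
    (fun m => plaqsOf (D.Ω m \ D.Ω (m + 1))) (plaqsOf ((D.Ω (D.k₀ + 1))ᶜ \ D.Zpp D.k)) (fun i => plaqsOf (dom D i))
    (plaqsOf (half D))
    (by
      -- Ω_m∖Ω_{m+1}, k₀ < m < k: "We have j = k", last term ≦ α
      intro m hm hmk p hp
      have hp' : p ∈ plaqsOf (dom D D.k) := by
        rw [dom_k D hkh]; exact plaqsOf_mono (hjEqK m hm hmk) hp
      refine ⟨X D D.k * Real.exp (-D.δ * D.dist p), hlast m hm hmk p hp, ?_⟩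
      have h := h198 D.k (by omega) le_rfl p hp'
      simp only [Nat.sub_self, pow_zero, inv_one] at h
      unfold X
      exact h)
    (by
      -- Ω^c_{k₀+1}∖Z″_k ⊆ Ω^c_k∖Z″_k (nested Ω's), j = k
      intro p hp
      have hsub : (D.Ω (D.k₀ + 1))ᶜ \ D.Zpp D.k ⊆ domK D := fun x hx =>
        ⟨fun hxk => hx.1 (Ω_antitone hΩ (by omega : D.k₀ + 1 ≤ D.k) hxk), hx.2⟩
      have hp' : p ∈ plaqsOf (dom D D.k) := by
        rw [dom_k D hkh]; exact plaqsOf_mono hsub hp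
      have h := h198 D.k (by omega) le_rfl p hp'
      unfold X
      exact h)
    (by
      -- the Z″-domains, h ≦ j < k
      intro j hj hjk' p hp
      have h := h198 j hj hjk'.le p hp
      unfold X
      exact h)
    (by
      -- the half domain: (1.91), (1.95), χ_{h,1/2} ⇒ (1.96)₁
      intro p hp
      exact ineq196_first_of_191_195 (L91h U hU p hp) (L95 U hU p hp) (half_lt_of_new189 D hU hbox hp) hα
        (hLinv0 D.h) (hLinv1 D.h) (hε0 D.h) (hε1 D.h) (hE D.h))
  -- the families cover the concrete regions of (1.24) at n = N
  refine chi124_top_of_lines D.Ω D.Zpp hk (D.Upp U) (fun m => plaqsOf (D.Ω m \ D.Ω (m + 1)))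
    (plaqsOf ((D.Ω (D.k₀ + 1))ᶜ \ D.Zpp D.k)) (fun i => plaqsOf (dom D i)) (plaqsOf (half D)) (fun m _ _ => subset_rfl) ?_
    subset_rfl ?_ ?_ h1 h2 h3 h4 h5
  · -- the top region Ω_{k−1}∖Ω_{k+1} ⊆ Ω_{k−1}∖Ω_k (Ω_{k+1} := Ω_k)
    have hk1 : D.k - 1 + 1 = D.k := by omega
    show plaqsOf (D.Ω (D.k - 1) \ D.Ω (D.k + 1)) ⊆ plaqsOf (D.Ω (D.k - 1) \ D.Ω (D.k - 1 + 1))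
    rw [hk1]
    exact plaqsOf_mono fun x hx => ⟨hx.1, fun hxk => hx.2 (hΩtop hxk)⟩
  · -- Z″_{i+1}∖Z″_i, h < i < k
    intro i hi hik
    show plaqsOf (D.Zpp (i + 1) \ D.Zpp i) ⊆ plaqsOf (dom D i)
    rw [dom_j D (by omega) (by omega)]
    exact subset_rfl
  · -- Z″_{h+1}∩Ω_h ⊆ (Z″_{h+1}∩Ω_h∩Ω″^∼_{h+1}) ∪ ((Ω″^∼_{h+1})ᶜ∩Ω_h)
    show plaqsOf (D.Zpp (D.h + 1) ∩ D.Ω D.h) ⊆ plaqsOf (dom D D.h) ∪ plaqsOf (half D)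
    rw [dom_h]
    have hcover : D.Zpp (D.h + 1) ∩ D.Ω D.h ⊆ domH D ∪ half D := by
      intro x hx
      by_cases hxT : x ∈ D.OmT
      · exact Or.inl ⟨hx, hxT⟩
      · exact Or.inr ⟨hxT, hx.2⟩
    -- `plaqsOf` splits over unions (named form: `B15Claim129Assembly.plaqsOf_union_subset`, p386619 — not imported, so that
    -- this file verifies on built modules)
    intro p hp
    rcases plaqsOf_mono hcover hp with h1 | h1 | h1 | h1 <;> rcases h1 with h | h
    · exact Or.inl (Or.inl h)
    · exact Or.inr (Or.inl h)
    · exact Or.inl (Or.inr (Or.inl h))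
    · exact Or.inr (Or.inr (Or.inl h))
    · exact Or.inl (Or.inr (Or.inr (Or.inl h)))
    · exact Or.inr (Or.inr (Or.inr (Or.inl h)))
    · exact Or.inl (Or.inr (Or.inr (Or.inr h)))
    · exact Or.inr (Or.inr (Or.inr (Or.inr h)))

/-- **(1.89), the proved part, WITH THE TWO DERIVED INPUTS TRACED TO THEIR PRINTED SOURCES**: as `claim189_assembly`, but with
p. 199's units inequality replaced by the [III] flow relation `ε_k ≦ (1+β₀)(k−j)^{1/2}ε_j` (`hflow`, via `hscale_of_flow`) and
p. 200's *"smaller than α"* replaced by the shell geometry `4(m − k₀)M ≦ dist(p, Λ)` on `Ω_m∖Ω_{m+1}` (`hgeom`: the first display of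
p. 200 read through r12's `shellSum_ge`, with the admissible-family domination as the hypothesis) and the choice of `M`
(`hlarge`: `X_k·e^{−4δM} ≦ α`, r12's `exists_M_lastTerm_lt`), via `hlast_of_largeM`. [cite: Balaban1989LargeFieldI, (1.89) p.198, pp.199–200] -/
theorem claim189_assembly_of_flow (D : Setting189 P G C ι) (hhk : D.h ≤ D.k₀) (hk : D.k₀ + 2 ≤ D.k)
    (hΩ : ∀ i, D.Ω (i + 1) ⊆ D.Ω i) (hΩtop : D.Ω D.k ⊆ D.Ω (D.k + 1))
    (hα : D.α = 1 / 12) (hβ0 : 0 ≤ D.β) (hβ : D.β ≤ 1 / 4) (hL₀ : 2 ≤ D.L₀) (hL₀L : D.L₀ ^ 2 ≤ D.L)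
    (hε0 : ∀ i, 0 ≤ D.ε i) (hε1 : ∀ i, D.ε i ≤ 1 / 10) (hB : 0 ≤ D.O1 * D.B₃ * D.B₅ * D.M ^ 5)
    (hδ : 0 ≤ D.δ) (hM : 0 ≤ D.M) (hdist : ∀ p, 0 ≤ D.dist p)
    {X' : ℝ} (hX' : ∀ j, 2 + X D j ≤ X') (hsmall : X' * ((D.L₀ ^ 2) ^ (D.k - D.k₀ - 1))⁻¹ ≤ 1 / 4)
    (hjEqK : ∀ m, D.k₀ < m → m < D.k → D.Ω m \ D.Ω (m + 1) ⊆ domK D)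
    -- p. 200, first display: the shell geometry, and the choice of M
    (hgeom : ∀ m, D.k₀ < m → m < D.k → ∀ p ∈ plaqsOf (D.Ω m \ D.Ω (m + 1)), 4 * ((m : ℝ) - D.k₀) * D.M ≤ D.dist p)
    (hlarge : X D D.k * Real.exp (-(4 * D.δ * D.M)) ≤ D.α)
    -- [III] (2.8): the flow relation behind p. 199's units inequality
    {β₀ : ℝ} (hβ₀0 : 0 ≤ β₀) (hβ₀ : β₀ ≤ 1 / 2)
    (hflow : ∀ j, D.h ≤ j → j < D.k → D.ε D.k ≤ (1 + β₀) * Real.sqrt ((D.k - j : ℕ) : ℝ) * D.ε j)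
    (hbox : ∀ p ∈ plaqsOf (half D), D.boxOf p ∈ D.halfcubes ∧ p ∈ D.plaqT (D.boxOf p))
    (L91h : ∀ U, new189 D U → ∀ p ∈ plaqsOf (half D),
      Ineq191 (dist1 (plaqHol (D.Upp U) p)) (D.devV'' U p) D.α ((D.L ^ D.h)⁻¹) (D.ε D.h) (E124 D.ε D.L D.η D.k D.h))
    (L95 : ∀ U, new189 D U → ∀ p ∈ plaqsOf (half D),
      Ineq195 (D.devV'' U p) (dist1 (plaqHol (D.Uhalf U (D.boxOf p)) p)) D.α ((D.L ^ D.h)⁻¹) (D.ε D.h)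
        (E124 D.ε D.L D.η D.k D.h))
    (L91 : ∀ U, new189 D U → ∀ j, D.h ≤ j → j ≤ D.k → ∀ p ∈ plaqsOf (dom D j),
      Ineq191 (dist1 (plaqHol (D.Upp U) p)) (D.dev97 U p) D.α ((D.L ^ j)⁻¹) (D.ε j) (E124 D.ε D.L D.η D.k j))
    (L97 : ∀ U, new189 D U → ∀ j, D.h ≤ j → j ≤ D.k → ∀ p ∈ plaqsOf (dom D j),
      Ineq191 (D.dev97 U p) (D.dev0 U p) D.α ((D.L ^ j)⁻¹) (D.ε j) (E124 D.ε D.L D.η D.k j))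
    (L80 : ∀ U, new189 D U → ∀ j, D.h ≤ j → j ≤ D.k → ∀ p ∈ plaqsOf (dom D j),
      B15.Ineq180 (D.dev0 U p) (D.ε D.k) D.η D.B₃ D.B₅ D.M D.δ (D.dist p) D.O1) :
    Claim189 (new189 D) (chiPP D) := by
  have hL2 : 2 ≤ D.L := by nlinarith
  have hX : 0 ≤ X D D.k := by
    have : X D D.k = D.O1 * D.B₃ * D.B₅ * D.M ^ 5 * (1 + (D.L ^ D.k)⁻¹ * D.α * D.ε D.k) ^ 2 := by unfold X; ring
    rw [this]; exact mul_nonneg hB (sq_nonneg _)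
  refine claim189_assembly D hhk hk hΩ hΩtop hα hβ0 hβ hL₀ hL₀L hε0 hε1 hB hδ hdist hX' hsmall hjEqK ?_
    (hscale_of_flow D hL2 hβ₀0 hβ₀ hε0 hflow) hbox L91h L95 L91 L97 L80
  intro m hm hmk p hp
  exact hlast_of_largeM D hδ hM hX hlarge hm (hgeom m hm hmk p hp) le_rfl

/-- **(1.89) WITH THE FULL DELETED PRODUCT `χ_h(Ω_h∩Z_h)χ″_k`**: print's *"The equality χ_h(Ω_h∩Z_h) = 1 is immediate"* (p. 198,
no argument printed) is the input `himm`; the rest is `claim189_assembly`. [cite: Balaban1989LargeFieldI, (1.89) p.198] -/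
theorem claim189_assembly_with_chiH (D : Setting189 P G C ι) (hhk : D.h ≤ D.k₀) (hk : D.k₀ + 2 ≤ D.k)
    (hΩ : ∀ i, D.Ω (i + 1) ⊆ D.Ω i) (hΩtop : D.Ω D.k ⊆ D.Ω (D.k + 1))
    (hα : D.α = 1 / 12) (hβ0 : 0 ≤ D.β) (hβ : D.β ≤ 1 / 4) (hL₀ : 2 ≤ D.L₀) (hL₀L : D.L₀ ^ 2 ≤ D.L)
    (hε0 : ∀ i, 0 ≤ D.ε i) (hε1 : ∀ i, D.ε i ≤ 1 / 10) (hB : 0 ≤ D.O1 * D.B₃ * D.B₅ * D.M ^ 5)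
    (hδ : 0 ≤ D.δ) (hdist : ∀ p, 0 ≤ D.dist p)
    {X' : ℝ} (hX' : ∀ j, 2 + X D j ≤ X') (hsmall : X' * ((D.L₀ ^ 2) ^ (D.k - D.k₀ - 1))⁻¹ ≤ 1 / 4)
    (hjEqK : ∀ m, D.k₀ < m → m < D.k → D.Ω m \ D.Ω (m + 1) ⊆ domK D)
    (hlast : ∀ m, D.k₀ < m → m < D.k → ∀ p ∈ plaqsOf (D.Ω m \ D.Ω (m + 1)),
      X D D.k * Real.exp (-D.δ * D.dist p) ≤ D.α)
    (hscale : ∀ j, D.h ≤ j → j < D.k → D.ε D.k * D.η ^ 2 ≤ (D.L ^ (D.k - j))⁻¹ * E124 D.ε D.L D.η D.k j)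
    (hbox : ∀ p ∈ plaqsOf (half D), D.boxOf p ∈ D.halfcubes ∧ p ∈ D.plaqT (D.boxOf p))
    (L91h : ∀ U, new189 D U → ∀ p ∈ plaqsOf (half D),
      Ineq191 (dist1 (plaqHol (D.Upp U) p)) (D.devV'' U p) D.α ((D.L ^ D.h)⁻¹) (D.ε D.h) (E124 D.ε D.L D.η D.k D.h))
    (L95 : ∀ U, new189 D U → ∀ p ∈ plaqsOf (half D),
      Ineq195 (D.devV'' U p) (dist1 (plaqHol (D.Uhalf U (D.boxOf p)) p)) D.α ((D.L ^ D.h)⁻¹) (D.ε D.h)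
        (E124 D.ε D.L D.η D.k D.h))
    (L91 : ∀ U, new189 D U → ∀ j, D.h ≤ j → j ≤ D.k → ∀ p ∈ plaqsOf (dom D j),
      Ineq191 (dist1 (plaqHol (D.Upp U) p)) (D.dev97 U p) D.α ((D.L ^ j)⁻¹) (D.ε j) (E124 D.ε D.L D.η D.k j))
    (L97 : ∀ U, new189 D U → ∀ j, D.h ≤ j → j ≤ D.k → ∀ p ∈ plaqsOf (dom D j),
      Ineq191 (D.dev97 U p) (D.dev0 U p) D.α ((D.L ^ j)⁻¹) (D.ε j) (E124 D.ε D.L D.η D.k j))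
    (L80 : ∀ U, new189 D U → ∀ j, D.h ≤ j → j ≤ D.k → ∀ p ∈ plaqsOf (dom D j),
      B15.Ineq180 (D.dev0 U p) (D.ε D.k) D.η D.B₃ D.B₅ D.M D.δ (D.dist p) D.O1)
    -- p. 198: "The equality χ_h(Ω_h∩Z_h) = 1 is immediate"
    (himm : ∀ U, new189 D U → chiH D U) :
    Claim189 (new189 D) (dropped189 D) := fun U hU =>
  And.intro (himm U hU) (claim189_assembly D hhk hk hΩ hΩtop hα hβ0 hβ hL₀ hL₀L hε0 hε1 hB hδ hdist hX' hsmall hjEqK hlast hscale hbox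
    L91h L95 L91 L97 L80 U hU)

open Classical in
/-- (1.89) IN THE PRINTED PRODUCT FORM `χ_new · χ″_k = χ_new` (as `{0,1}`-valued functions of the configuration), from
`claim189_assembly` via r12's `claim129_iff_indicator` (`Claim189 = Claim129`). [cite: Balaban1989LargeFieldI, (1.89) p.198] -/
theorem claim189_assembly_indicator (D : Setting189 P G C ι) (h : Claim189 (new189 D) (chiPP D)) (U : C) :
    (if new189 D U then (1 : ℝ) else 0) * (if chiPP D U then 1 else 0) = if new189 D U then 1 else 0 :=
  (claim129_iff_indicator (new189 D) (chiPP D)).1 h U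

end Literature.MathematicalPhysics.QuantumFieldTheory.Balaban1983to89.B15Claim189Assembly
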